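import Mathlib
import Summits.Ventures.PercRepro2.AS3Cases

/-!
# Parallel pairs: the swap, the one-copy rule, and the capacity-2 left configuration
(seat mine-b, cell pub-perc-repro2; conjectures/MINE-B.md §13.3)

A **parallel pair** `p₁, p₂` of an increasing event `A₁` (`IsParallel`): the two elements are distinct,
the transposition `swap₂ p₁ p₂` preserves the event, and one copy does the work of two
(`A₁ (insert p₁ (insert p₂ S)) → A₁ (insert p₁ S)`).  For a clutter this says that `p₁, p₂` are parallel
elements (no member contains both, swapping them is an automorphism) — the doubled element of a
2-sum with a piece of packing number 2.  We record what the swap does to witnesses and packings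
(`witness_swap`, `kDisj_image_swap₂`, `witness_kDisj_swap`), the one-copy rule at the witness level
(`witness_one`, `witness_normalise`), and the **capacity-2 left configuration** `leftCfg₂` of a
configuration of `E₁ ⊕ E₂`: the left part without the pair, plus the copies the right part supplies —
`p₁` when the piece event `A₂` holds there, `p₂` as well when it occurs twice disjointly (`copies₂`).
The transfer lemma for 2-sums with packing-2 pieces (TwoSumCap2.lean) is stated on it.
-/

open Finset

namespace Summit.Ventures.PercRepro2

namespace StepZero

open ReimerCube

variable {E₁ E₂ : Type*} [DecidableEq E₁]

/-! ## The swap of a parallel pair -/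

/-- the transposition of `p₁` and `p₂` -/
def swap₂ (p₁ p₂ : E₁) (x : E₁) : E₁ := if x = p₁ then p₂ else if x = p₂ then p₁ else x

omit [DecidableEq E₁] in
/-- the event `A` with the element `q` deleted (`q` never counts as present) -/
def del (A : Finset E₁ → Prop) (q : E₁) (S : Finset E₁) : Prop := A (S.erase q)

/-- deleting an element keeps an event increasing -/
lemma incr_del {A : Finset E₁ → Prop} (hA : Incr A) (q : E₁) : Incr (del A q) :=
  fun _ _ hST h => hA (Finset.erase_subset_erase q hST) h

/-- `p₁, p₂` form a parallel pair for the event `A₁`: distinct, the swap preserves the event, and one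
copy does the work of two -/
structure IsParallel (A₁ : Finset E₁ → Prop) (p₁ p₂ : E₁) : Prop where
  ne : p₁ ≠ p₂
  swap : ∀ S, A₁ (S.image (swap₂ p₁ p₂)) → A₁ S
  one : ∀ S, A₁ (insert p₁ (insert p₂ S)) → A₁ (insert p₁ S)

/-- the transposition is an involution -/
lemma swap₂_involutive (p₁ p₂ : E₁) : Function.Involutive (swap₂ p₁ p₂) := by
  intro x
  unfold swap₂
  by_cases h1 : x = p₁
  · subst h1
    by_cases h2 : p₂ = x
    · simp [h2]
    · simp [h2]
  · by_cases h2 : x = p₂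
    · subst h2
      simp [h1]
    · simp [h1, h2]

/-- the transposition sends `p₁` to `p₂` -/
lemma swap₂_left (p₁ p₂ : E₁) : swap₂ p₁ p₂ p₁ = p₂ := by simp [swap₂]

/-- the transposition sends `p₂` to `p₁` -/
lemma swap₂_right (p₁ p₂ : E₁) (h : p₁ ≠ p₂) : swap₂ p₁ p₂ p₂ = p₁ := by
  simp [swap₂, h.symm]

/-- the transposition fixes every other element -/
lemma swap₂_of_ne (p₁ p₂ x : E₁) (h1 : x ≠ p₁) (h2 : x ≠ p₂) : swap₂ p₁ p₂ x = x := by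
  simp [swap₂, h1, h2]

/-- applying the swap twice to a set gives the set back -/
lemma image_swap₂_image_swap₂ (p₁ p₂ : E₁) (S : Finset E₁) :
    (S.image (swap₂ p₁ p₂)).image (swap₂ p₁ p₂) = S := by
  rw [Finset.image_image, (swap₂_involutive p₁ p₂).comp_self, Finset.image_id]

/-- membership in the swapped set -/
lemma mem_image_swap₂ (p₁ p₂ : E₁) (S : Finset E₁) (x : E₁) :
    x ∈ S.image (swap₂ p₁ p₂) ↔ swap₂ p₁ p₂ x ∈ S := by
  constructor
  · intro h
    obtain ⟨y, hy, rfl⟩ := Finset.mem_image.mp h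
    rwa [swap₂_involutive]
  · intro h
    exact Finset.mem_image.mpr ⟨_, h, swap₂_involutive p₁ p₂ x⟩

/-- the swap preserves inclusions -/
lemma image_swap₂_subset_image_swap₂ (p₁ p₂ : E₁) {S T : Finset E₁} (h : S ⊆ T) :
    S.image (swap₂ p₁ p₂) ⊆ T.image (swap₂ p₁ p₂) :=
  Finset.image_subset_image h

/-- a set avoiding both elements is fixed by the swap -/
lemma image_swap₂_of_not_mem (p₁ p₂ : E₁) {S : Finset E₁} (h1 : p₁ ∉ S) (h2 : p₂ ∉ S) :
    S.image (swap₂ p₁ p₂) = S := by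
  ext x
  rw [mem_image_swap₂]
  by_cases hx1 : x = p₁
  · subst hx1
    rw [swap₂_left]
    exact ⟨fun h => absurd h h2, fun h => absurd h h1⟩
  · by_cases hx2 : x = p₂
    · subst hx2
      by_cases h12 : p₁ = x
      · subst h12; simp [swap₂]
      · rw [swap₂_right _ _ h12]
        exact ⟨fun h => absurd h h1, fun h => absurd h h2⟩
    · rw [swap₂_of_ne _ _ _ hx1 hx2]

/-- the swap moves `p₁` to `p₂` on a set avoiding both -/
lemma image_swap₂_insert (p₁ p₂ : E₁) {S : Finset E₁} (h1 : p₁ ∉ S) (h2 : p₂ ∉ S) :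
    (insert p₁ S).image (swap₂ p₁ p₂) = insert p₂ S := by
  rw [Finset.image_insert, swap₂_left, image_swap₂_of_not_mem p₁ p₂ h1 h2]

/-! ## Witnesses under the swap and the one-copy rule -/

/-- the swap maps witnesses of `A₁` to witnesses -/
lemma witness_swap {A₁ : Finset E₁ → Prop} {p₁ p₂ : E₁} (hpar : IsParallel A₁ p₁ p₂)
    {K : Finset E₁} (hK : ∀ T, K ⊆ T → A₁ T) : ∀ T, K.image (swap₂ p₁ p₂) ⊆ T → A₁ T := by
  intro T hT
  apply hpar.swap
  apply hK
  intro x hx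
  rw [mem_image_swap₂]
  rw [← image_swap₂_image_swap₂ p₁ p₂ K] at hx
  rw [mem_image_swap₂] at hx
  exact hT hx

/-- `kDisj` is invariant under the swap -/
lemma kDisj_image_swap₂ {A₁ : Finset E₁ → Prop} {p₁ p₂ : E₁} (hpar : IsParallel A₁ p₁ p₂) :
    ∀ (k : ℕ) (S : Finset E₁), kDisj A₁ k (S.image (swap₂ p₁ p₂)) → kDisj A₁ k S
  | 0, S, _ => trivial
  | k + 1, S, h => by
    obtain ⟨K, L, hK, hL, hKL, hAK, hAL⟩ := h
    refine ⟨K.image (swap₂ p₁ p₂), L.image (swap₂ p₁ p₂), ?_, ?_, ?_, witness_swap hpar hAK, ?_⟩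
    · intro x hx
      rw [mem_image_swap₂] at hx
      have := hK hx
      rwa [mem_image_swap₂, swap₂_involutive] at this
    · intro x hx
      rw [mem_image_swap₂] at hx
      have := hL hx
      rwa [mem_image_swap₂, swap₂_involutive] at this
    · exact Finset.disjoint_image (swap₂_involutive p₁ p₂).injective |>.mpr hKL
    · intro T hT
      apply kDisj_image_swap₂ hpar k
      apply hAL
      intro x hx
      rw [mem_image_swap₂]
      rw [← image_swap₂_image_swap₂ p₁ p₂ L] at hx
      rw [mem_image_swap₂] at hx
      exact hT hx

/-- the swap maps witnesses of `kDisj A₁ k` to witnesses -/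
lemma witness_kDisj_swap {A₁ : Finset E₁ → Prop} {p₁ p₂ : E₁} (hpar : IsParallel A₁ p₁ p₂) (k : ℕ)
    {L : Finset E₁} (hL : ∀ T, L ⊆ T → kDisj A₁ k T) :
    ∀ T, L.image (swap₂ p₁ p₂) ⊆ T → kDisj A₁ k T := by
  intro T hT
  apply kDisj_image_swap₂ hpar k
  apply hL
  intro x hx
  rw [mem_image_swap₂]
  rw [← image_swap₂_image_swap₂ p₁ p₂ L] at hx
  rw [mem_image_swap₂] at hx
  exact hT hx

/-- a witness containing both copies stays a witness after dropping `p₂` -/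
lemma witness_one {A₁ : Finset E₁ → Prop} {p₁ p₂ : E₁} (hpar : IsParallel A₁ p₁ p₂)
    {K : Finset E₁} (hK : ∀ T, K ⊆ T → A₁ T) (h1 : p₁ ∈ K) :
    ∀ T, K.erase p₂ ⊆ T → A₁ T := by
  intro T hT
  have hT1 : p₁ ∈ T := hT (Finset.mem_erase.mpr ⟨hpar.ne, h1⟩)
  have h := hK (insert p₂ T) (by
    intro x hx
    by_cases hx2 : x = p₂
    · subst hx2; exact Finset.mem_insert_self _ _
    · exact Finset.mem_insert_of_mem (hT (Finset.mem_erase.mpr ⟨hx2, hx⟩)))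
  have h' : A₁ (insert p₁ (insert p₂ (T.erase p₁))) := by
    have e : insert p₁ (insert p₂ (T.erase p₁)) = insert p₂ T := by
      rw [Finset.insert_comm, Finset.insert_erase hT1]
    rw [e]; exact h
  have := hpar.one _ h'
  rwa [Finset.insert_erase hT1] at this

/-- **normalisation of a witness using a copy**: if a witness of `A₁` meets `{p₁, p₂}`, then its trace
outside the pair together with `p₁` alone is a witness -/
lemma witness_normalise {A₁ : Finset E₁ → Prop} {p₁ p₂ : E₁} (hpar : IsParallel A₁ p₁ p₂)
    {K : Finset E₁} (hK : ∀ T, K ⊆ T → A₁ T) (h : p₁ ∈ K ∨ p₂ ∈ K) :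
    ∀ T, insert p₁ ((K.erase p₁).erase p₂) ⊆ T → A₁ T := by
  by_cases h1 : p₁ ∈ K
  · -- drop `p₂` if present
    have h' := witness_one hpar hK h1
    intro T hT
    apply h'
    intro x hx
    rw [Finset.mem_erase] at hx
    by_cases hx1 : x = p₁
    · subst hx1; exact hT (Finset.mem_insert_self _ _)
    · exact hT (Finset.mem_insert_of_mem (Finset.mem_erase.mpr ⟨hx.1, Finset.mem_erase.mpr ⟨hx1, hx.2⟩⟩))
  · -- `p₂ ∈ K`, `p₁ ∉ K`: swap
    have h2 : p₂ ∈ K := h.resolve_left h1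
    have hK' : K = insert p₂ ((K.erase p₁).erase p₂) := by
      rw [Finset.erase_eq_of_notMem h1, Finset.insert_erase h2]
    have e : K.image (swap₂ p₁ p₂) = insert p₁ ((K.erase p₁).erase p₂) := by
      conv_lhs => rw [hK']
      rw [Finset.image_insert, swap₂_right _ _ hpar.ne, image_swap₂_of_not_mem p₁ p₂
        (fun h => (Finset.mem_erase.mp (Finset.mem_of_mem_erase h)).1 rfl)
        (fun h => (Finset.mem_erase.mp h).1 rfl)]
    intro T hT
    exact witness_swap hpar hK T (e ▸ hT)

/-- the swap moves `p₂` to `p₁` on a set avoiding both -/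
lemma image_swap₂_insert' (p₁ p₂ : E₁) (hne : p₁ ≠ p₂) {S : Finset E₁} (h1 : p₁ ∉ S) (h2 : p₂ ∉ S) :
    (insert p₂ S).image (swap₂ p₁ p₂) = insert p₁ S := by
  rw [Finset.image_insert, swap₂_right _ _ hne, image_swap₂_of_not_mem p₁ p₂ h1 h2]

/-! ## The capacity-2 left configuration -/

section Cap2

variable (A₂ : Finset E₂ → Prop) (p₁ p₂ : E₁)

open Classical

/-- the copies of `p` supplied by the right part `R`: `p₁` when `A₂` holds on `R`, and also `p₂` when
`A₂` occurs twice disjointly in `R` -/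
noncomputable def copies₂ (R : Finset E₂) : Finset E₁ :=
  (if A₂ R then {p₁} else ∅) ∪ (if DOcc A₂ A₂ R then {p₂} else ∅)

/-- the capacity-2 left configuration: the left part of `X` without the pair, plus the copies the right
part supplies -/
noncomputable def leftCfg₂ (X : Finset (E₁ ⊕ E₂)) : Finset E₁ :=
  (X.toLeft.erase p₁).erase p₂ ∪ copies₂ A₂ p₁ p₂ X.toRight

variable {A₂ p₁ p₂}

/-- membership in the copies supplied by a right part -/
lemma mem_copies₂ {R : Finset E₂} {x : E₁} :
    x ∈ copies₂ A₂ p₁ p₂ R ↔ (x = p₁ ∧ A₂ R) ∨ (x = p₂ ∧ DOcc A₂ A₂ R) := by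
  unfold copies₂
  by_cases h1 : A₂ R <;> by_cases h2 : DOcc A₂ A₂ R <;> simp [h1, h2]

/-- the copies are monotone in the right part (for increasing `A₂`) -/
lemma copies₂_mono (hA₂ : Incr A₂) {R R' : Finset E₂} (h : R ⊆ R') :
    copies₂ A₂ p₁ p₂ R ⊆ copies₂ A₂ p₁ p₂ R' := by
  intro x hx
  rw [mem_copies₂] at hx ⊢
  rcases hx with ⟨rfl, h1⟩ | ⟨rfl, h2⟩
  · exact Or.inl ⟨rfl, hA₂ h h1⟩
  · exact Or.inr ⟨rfl, incr_dOcc A₂ A₂ h h2⟩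

/-- the capacity-2 left configuration is monotone -/
lemma leftCfg₂_mono (hA₂ : Incr A₂) {S T : Finset (E₁ ⊕ E₂)} (hST : S ⊆ T) :
    leftCfg₂ A₂ p₁ p₂ S ⊆ leftCfg₂ A₂ p₁ p₂ T :=
  Finset.union_subset_union
    (Finset.erase_subset_erase _ (Finset.erase_subset_erase _ (Finset.toLeft_subset_toLeft hST)))
    (copies₂_mono hA₂ (Finset.toRight_subset_toRight hST))

/-- the capacity-2 left configuration of a disjoint sum -/
lemma leftCfg₂_disjSum (T : Finset E₁) (R : Finset E₂) :
    leftCfg₂ A₂ p₁ p₂ (T.disjSum R) = (T.erase p₁).erase p₂ ∪ copies₂ A₂ p₁ p₂ R := by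
  simp [leftCfg₂]

/-- elements of the left configuration other than the copies come from the left part -/
lemma mem_toLeft_of_mem_leftCfg₂ {X : Finset (E₁ ⊕ E₂)} {x : E₁} (hx : x ∈ leftCfg₂ A₂ p₁ p₂ X)
    (h1 : x ≠ p₁) (h2 : x ≠ p₂) : x ∈ X.toLeft := by
  unfold leftCfg₂ at hx
  rw [Finset.mem_union, mem_copies₂] at hx
  rcases hx with hx | ⟨rfl, -⟩ | ⟨rfl, -⟩
  · exact Finset.mem_of_mem_erase (Finset.mem_of_mem_erase hx)
  · exact absurd rfl h1
  · exact absurd rfl h2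

/-- a copy in the left configuration means the right part carries `A₂` -/
lemma A₂_of_mem_leftCfg₂ {X : Finset (E₁ ⊕ E₂)} {x : E₁}
    (hx : x ∈ leftCfg₂ A₂ p₁ p₂ X) (h : x = p₁ ∨ x = p₂) : A₂ X.toRight := by
  unfold leftCfg₂ at hx
  rw [Finset.mem_union, mem_copies₂] at hx
  rcases hx with hx | ⟨-, h1⟩ | ⟨-, h2⟩
  · exfalso
    rcases h with rfl | rfl
    · exact (Finset.mem_erase.mp (Finset.mem_of_mem_erase hx)).1 rfl
    · exact (Finset.mem_erase.mp hx).1 rfl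
  · exact h1
  · obtain ⟨K, -, hK, -, -, hAK, -⟩ := h2
    exact hAK _ hK

/-- the second copy in the left configuration means `A₂` occurs twice disjointly on the right -/
lemma dOcc_of_mem_leftCfg₂ (hne : p₁ ≠ p₂) {X : Finset (E₁ ⊕ E₂)} (hx : p₂ ∈ leftCfg₂ A₂ p₁ p₂ X) :
    DOcc A₂ A₂ X.toRight := by
  unfold leftCfg₂ at hx
  rw [Finset.mem_union, mem_copies₂] at hx
  rcases hx with hx | ⟨h, -⟩ | ⟨-, h2⟩
  · exact absurd (Finset.mem_erase.mp hx).1 (fun h => h rfl)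
  · exact absurd h.symm hne
  · exact h2

/-- the lift of a left configuration for the capacity-2 configuration -/
lemma leftCfg₂_lift_subset {K : Finset (E₁ ⊕ E₂)} {T : Finset E₁}
    (hT : leftCfg₂ A₂ p₁ p₂ K ⊆ T) :
    leftCfg₂ A₂ p₁ p₂ ((T ∪ K.toLeft).disjSum K.toRight) ⊆ T := by
  rw [leftCfg₂_disjSum]
  apply Finset.union_subset
  · intro x hx
    rw [Finset.mem_erase, Finset.mem_erase, Finset.mem_union] at hx
    rcases hx with ⟨hx2, hx1, hx | hx⟩
    · exact hx
    · apply hT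
      unfold leftCfg₂
      exact Finset.mem_union_left _ (Finset.mem_erase.mpr ⟨hx2, Finset.mem_erase.mpr ⟨hx1, hx⟩⟩)
  · intro x hx
    apply hT
    unfold leftCfg₂
    exact Finset.mem_union_right _ hx

/-- the left trace of a subset of the left configuration lies in the left part -/
lemma trace_subset_toLeft {X : Finset (E₁ ⊕ E₂)} {K' : Finset E₁} (hK' : K' ⊆ leftCfg₂ A₂ p₁ p₂ X) :
    (K'.erase p₁).erase p₂ ⊆ X.toLeft := by
  intro x hx
  rw [Finset.mem_erase, Finset.mem_erase] at hx
  exact mem_toLeft_of_mem_leftCfg₂ (hK' hx.2.2) hx.2.1 hx.1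

end Cap2

end StepZero

end Summit.Ventures.PercRepro2
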